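import Summits.CriticalPhenomena.PercolationContinuityZ3.Theorems.Transplant.Slab111SKDefs
import HarnessLib

/-!
# The bcc (111)-films at small thickness, I: the KERNEL CHECKER — the radius-`3` bitboard of «Slab111SKDefs» with ELEVATOR bonds and the
# EXIT-FORM need mask (swap-pair plans for `(Bcc111.hexShadow m).ShapedLinkageX 3`, `m ≤ 9`)

builds on p205010 (kernel theorem, internal audit signed; external expert review pending) — NOT used in this file.  Lane `prim-bschramm`, seat
`prim-bschramm-p2` (gen 49; class C1b = films / other 3D lattices at their own critical point, METHOD = input substitution; memo
`HOME/bschramm/P2-LATTICES.md` §160); helper file (`--supports stmt-CriticalPhenomena-4575 --as helper`).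

WHY.  «Bcc111Route5» certifies the exit-form routing node `(Bcc111.hexShadow m).ShapedLinkageX 3` of «HexShadowVRouteDataX» for every `m ≥ 5` by the
`K_{2,3}` elevator-hub template with lifted planar legs; at `m = 3, 4` the lifts of «Bcc111Lift» do not exist (every column of `F_4(bcc)` carries at most
one elevator pair, `F_3(bcc)` is thinner still), although swap pairs exist for every certified triple (memo §158 (4), §159 add. 2).  As for the `(111)`-films
of `ℤ³` at small thickness («Slab111SKDefs», gen 38) the certificate can then be EXPLICIT and checked by the kernel on a bitboard.  This file is the twin
of «Slab111SKDefs» for the bcc (111)-films — SAME bit layout (a film vertex over `hexBall z 4` with shadow `z + (a, b)` and level `L ≤ 9` is the bit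
`i = 100·L + 10·(a+5) + (b+5) < 1000`; the level structure `L ≡ c₀ + a + 2b (mod 3)` of `F_m(bcc)` over its hexagonal shadow is literally that of `F_k`),
with TWO changes:
* the adjacency has a fourth offset, the in-column ELEVATOR `+300` (`(p, L) ∼ (p, L+3)`, «Bcc111FilmLifts».`adj_vtx_elev`) besides the three up-steps
  `+110, +99, +91` (`adjE`, `nbhE`, and everything built on them: `reachE`, `bfsPathE`, `pathOKE`, the context `CtxE`);
* the need mask mirrors the EXIT form `HexShadow.TerminalsX` («HexShadowVRouteDataX»): `Terminals` (verbatim the «Slab111SKDefs» mirror) AND an exit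
  neighbour of `w'` outside `W`, inside the cleared window `{a ≤ t_D, a + b ≤ s_D}` (second window bound `wSD`), off the columns of `z, E₁, E₂`
  (`CtxE.exitM`).
Layout-free parts (`dL`, `dA`, `dB`, `bitOf`, `sdiff`, `lowIdx`, `maskBelow`, `maskOfList`, `endsOK`, `orFold`, `rd`, `rdMask`, `colSlots`) are
reused from «Slab111SKDefs».  Soundness: «Bcc111SKBits» … «Bcc111SKCase».  Python mirror and generator: HOME/prim-bschramm-p2-g49/b111/.
[cite: DuminilCopinSidoraviciusTassion2016, §2.3 (proof of Fact 2: the three disjoint paths in B_R(z))] [cite: ConwaySloane1999, Ch. 4 §7.1]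
-/

namespace Summit.CriticalPhenomena.PercolationContinuityZ3.Theorems.Transplant

namespace Bcc111.SK

open Slab111.SK (dL dA dB bitOf sdiff lowStep lowIdx maskOfList endsOK maskBelow orFold rd rdMask colSlots)

/-! ## §1 The bitboard with elevators -/

/-- Index adjacency of the bcc (111)-film: the two indices differ by one of the three up-step offsets or by the elevator offset `300`. [cite: ConwaySloane1999, Ch. 4 §7.1] -/
def adjE (i j : ℕ) : Bool :=
  j == i + 110 || j == i + 99 || j == i + 91 || j == i + 300 || i == j + 110 || i == j + 99 || i == j + 91 || i == j + 300

/-- **The neighbourhood of a vertex set** inside the universe `u`: eight shifts (six planar steps, two elevators). [folklore] -/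
def nbhE (u m : ℕ) : ℕ :=
  ((m <<< 110) ||| (m <<< 99) ||| (m <<< 91) ||| (m <<< 300) ||| (m >>> 110) ||| (m >>> 99) ||| (m >>> 91) ||| (m >>> 300)) &&& u

/-- Iterated neighbourhood inside `region` (fuel-bounded, stops at the fixpoint). [folklore] -/
def reachGoE (u region : ℕ) : ℕ → ℕ → ℕ
  | 0, cur => cur
  | f + 1, cur => let nxt := (cur ||| nbhE u cur) &&& region; bif nxt == cur then cur else reachGoE u region f nxt

/-- **All vertices reachable from `src ∩ region` by steps inside `region`.** [folklore] -/
def reachE (u region src : ℕ) : ℕ := reachGoE u region 200 (src &&& region)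

/-- BFS layers from the last layer outward inside `reg`, until the layer containing `s` (fuel-bounded). [folklore] -/
def layersGoE (u reg s : ℕ) : ℕ → List ℕ → ℕ → Option (List ℕ)
  | 0, _, _ => none
  | f + 1, layers, vis =>
    match layers with
    | [] => none
    | cur :: _ =>
      let nxt := sdiff (nbhE u cur &&& reg) vis
      bif nxt == 0 then none else bif Nat.testBit nxt s then some (nxt :: layers) else layersGoE u reg s f (nxt :: layers) (vis ||| nxt)

/-- Walking down the BFS layers from `cur`, always to the lowest-index neighbour in the next layer. [folklore] -/
def walkDownE (u : ℕ) : List ℕ → ℕ → List ℕ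
  | [], cur => [cur]
  | L :: rest, cur => cur :: walkDownE u rest (lowIdx (nbhE u (bitOf cur) &&& L))

/-- **The canonical shortest path from `s` to `t`** with all other vertices in `reg` (none if there is none). [folklore] -/
def bfsPathE (u reg s t : ℕ) : Option (List ℕ) :=
  bif s == t then some [s] else
    match layersGoE u (reg ||| bitOf s ||| bitOf t) s 60 [bitOf t] (bitOf t) with
    | some (_ :: rest) => some (walkDownE u rest s)
    | _ => none

/-- Re-validation of an index path: all vertices in `reg`, consecutive indices adjacent, no repeated index. [folklore] -/
def pathOKE (reg : ℕ) : List ℕ → ℕ → Bool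
  | [], _ => true
  | [i], seen => Nat.testBit reg i && !Nat.testBit seen i
  | i :: j :: rest, seen => Nat.testBit reg i && !Nat.testBit seen i && adjE i j && pathOKE reg (j :: rest) (seen ||| bitOf i)

/-! ## §2 The case context -/

/-- **A case** of the bcc (111) exit-form certificate: thickness `k = m ≤ 9`, centre class `c₀`, clip parameters of the rerouting block (`tR, sR`; `3` =
unclipped), window bounds (`wT, wS` for the `Terminals` window `{a ≤ t_D, a + b ≤ s_R}`, and `wSD` for the exit window's `a + b ≤ s_D`; `9` = unconstrained),
and the instance's cleared mask `W`. [folklore] -/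
structure CtxE where
  /-- thickness -/
  k : ℕ
  /-- centre class -/
  c0 : ℕ
  /-- `t`-clip of the rerouting block: `a ≤ tR` -/
  tR : ℕ
  /-- `s`-clip of the rerouting block: `a + b ≤ sR` -/
  sR : ℕ
  /-- window bound in the `t` direction (`a ≤ wT`), both windows -/
  wT : ℕ
  /-- `Terminals` window bound in the `s` direction (`a + b ≤ wS`) -/
  wS : ℕ
  /-- exit window bound in the `s` direction (`a + b ≤ wSD`) -/
  wSD : ℕ
  /-- the cleared vertex mask -/
  W : ℕ

/-- An index is a film vertex over `hexBall z 4` (digits in range, `triNorm ≤ 4`, level `≤ k`, right class). [folklore] -/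
def CtxE.validB (C : CtxE) (i : ℕ) : Bool :=
  decide (i < 1000) && decide (1 ≤ dA i) && decide (dA i ≤ 9) && decide (1 ≤ dB i) && decide (dB i ≤ 9) && decide (6 ≤ dA i + dB i) &&
    decide (dA i + dB i ≤ 14) && decide (dL i ≤ C.k) && (dL i % 3 == (C.c0 + dA i + 2 * dB i) % 3)

/-- The universe mask. [folklore] -/
def CtxE.univ (C : CtxE) : ℕ := maskBelow C.validB 1000

/-- Column test: over the rerouting block `blkR 3 z tR sR` (`triNorm ≤ 3`, `a ≤ tR`, `a + b ≤ sR`). [folklore] -/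
def CtxE.inRB (C : CtxE) (i : ℕ) : Bool :=
  C.validB i && decide (2 ≤ dA i) && decide (dA i ≤ 8) && decide (2 ≤ dB i) && decide (dB i ≤ 8) && decide (7 ≤ dA i + dB i) &&
    decide (dA i + dB i ≤ 13) && decide (dA i ≤ C.tR + 5) && decide (dA i + dB i ≤ C.sR + 10)

/-- `Terminals` window test (`a ≤ wT`, `a + b ≤ wS`). [folklore] -/
def CtxE.inWinB (C : CtxE) (i : ℕ) : Bool := C.validB i && decide (dA i ≤ C.wT + 5) && decide (dA i + dB i ≤ C.wS + 10)

/-- Exit window test (`a ≤ wT`, `a + b ≤ wSD`). [folklore] -/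
def CtxE.inWin2B (C : CtxE) (i : ℕ) : Bool := C.validB i && decide (dA i ≤ C.wT + 5) && decide (dA i + dB i ≤ C.wSD + 10)

/-- Centre-column test. [folklore] -/
def CtxE.cenB (C : CtxE) (i : ℕ) : Bool := C.validB i && (dA i == 5) && (dB i == 5)

/-- The rerouting mask `W ∩ \overline{blkR}`. [folklore] -/
def CtxE.WR (C : CtxE) : ℕ := C.W &&& maskBelow C.inRB 1000
/-- The `Terminals` window mask. [folklore] -/
def CtxE.win (C : CtxE) : ℕ := maskBelow C.inWinB 1000
/-- The exit window mask. [folklore] -/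
def CtxE.win2 (C : CtxE) : ℕ := maskBelow C.inWin2B 1000
/-- The centre-column mask. [folklore] -/
def CtxE.cen (C : CtxE) : ℕ := maskBelow C.cenB 1000

/-- The column mask of an index (all universe vertices with the same column digits). [folklore] -/
def CtxE.colM (C : CtxE) (i : ℕ) : ℕ := (colSlots <<< (i % 100)) &&& C.univ

/-- The list of universe neighbours of an index (planar steps and elevators). [folklore] -/
def CtxE.nbrList (C : CtxE) (e : ℕ) : List ℕ :=
  [e + 110, e + 99, e + 91, e + 300, e - 110, e - 99, e - 91, e - 300].filter fun j => adjE e j && Nat.testBit C.univ j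

/-! ## §3 The certified-terminal filter, exit form -/

/-- Outside neighbours: window film vertices adjacent to `e` not in `W`. [folklore] -/
def CtxE.outs (C : CtxE) (e : ℕ) : List ℕ := (C.nbrList e).filter fun j => Nat.testBit C.win j && !Nat.testBit C.W j
/-- Window neighbours of `e`. [folklore] -/
def CtxE.ins (C : CtxE) (e : ℕ) : List ℕ := (C.nbrList e).filter fun j => Nat.testBit C.win j

/-- The witness condition of a quadruple `(o₁, a₁, o₂, a₂)` for the pair `(e₁, e₂)` (the distinctness clauses of `HexShadow.Terminals.nbrs`). [folklore] -/
def CtxE.quadOK (C : CtxE) (e1 e2 o1 a1 o2 a2 : ℕ) : Bool :=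
  (a1 != o1) && (a1 != e2) && (o2 != o1) && (o2 != a1) && (a2 != o2) && (a2 != e1) && (a2 != o1) && ((a1 != a2) || Nat.testBit C.cen a1)

/-- The `Terminals` part of the need mask of an ordered terminal pair (verbatim the «Slab111SKDefs» mirror of `HexShadow.Terminals`).
[cite: DuminilCopinSidoraviciusTassion2016, §2.3 (proof of Fact 2: u', v', w')] -/
def CtxE.needMask0 (C : CtxE) (e1 e2 : ℕ) : ℕ :=
  orFold (C.outs e1) fun o1 => orFold (C.ins e1) fun a1 => orFold (C.outs e2) fun o2 => orFold (C.ins e2) fun a2 =>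
    bif C.quadOK e1 e2 o1 a1 o2 a2 then
      sdiff C.W (C.cen ||| C.colM e1 ||| C.colM e2 ||| C.colM o1 ||| C.colM a1 ||| C.colM a2 ||| C.colM o2)
    else 0

/-- **The exit mask of a pair**: all universe vertices with a neighbour outside `W`, inside the exit window, off the columns of the centre and of
`e₁, e₂` (mirror of the field `w'x` of `HexShadow.TerminalsX`). [cite: DuminilCopinSidoraviciusTassion2016, §2.3 (proof of Fact 2: "an open self-avoiding path π from w' … all the edges of which lie outside B̄_R(z)")] -/
def CtxE.exitM (C : CtxE) (e1 e2 : ℕ) : ℕ := nbhE C.univ (sdiff (sdiff C.win2 C.W) (C.cen ||| C.colM e1 ||| C.colM e2))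

/-- **The need mask of an ordered terminal pair, EXIT FORM**: all `w'` for which `(E₁, E₂, w')` passes the bitboard mirror of `HexShadow.TerminalsX`.
[cite: DuminilCopinSidoraviciusTassion2016, §2.3 (proof of Fact 2: u', v', w')] -/
def CtxE.needMask (C : CtxE) (e1 e2 : ℕ) : ℕ := C.needMask0 e1 e2 &&& C.exitM e1 e2

/-- **The terminal list**: rerouting vertices off the centre column with an outside neighbour, in increasing order. [folklore] -/
def CtxE.esList (C : CtxE) : List ℕ := (List.range 1000).filter fun i => Nat.testBit C.WR i && !Nat.testBit C.cen i && !(C.outs i).isEmpty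

/-! ## §4 Plans and their cover masks -/

/-- **The cover mask of a plan** `(c₁, y, b, c₂, avoid)` for the pair `(e₁, e₂)`: all `w'` reachable from `b` off routing 1 and from `y` off routing 2,
where routing 1 is the canonical path `e₁ ⇝ c₁ → y ⇝ e₂` and routing 2 is `e₁ ⇝ c₂ → b ⇝ e₂`; `0` if the plan is invalid (verbatim «Slab111SKDefs» over
the elevator adjacency). [cite: DuminilCopinSidoraviciusTassion2016, §2.3 (proof of Fact 2)] -/
def CtxE.coverOf (C : CtxE) (e1 e2 c1 y b c2 avoid : ℕ) : ℕ :=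
  let u := C.univ
  let W := C.W
  let WR := C.WR
  let static := (e1 != e2) && (y != b) && (y != e1) && (b != e1) && (b != e2) && (c1 != e2) && (c2 != e2) && (y != e2) &&
    ((c1 == e1) || Nat.testBit WR c1) && ((c2 == e1) || Nat.testBit WR c2) && Nat.testBit WR y && Nat.testBit WR b && Nat.testBit W b &&
    adjE c1 y && adjE c1 b && adjE c2 y && adjE c2 b && (c1 != y) && (c1 != b) && (c2 != y) && (c2 != b) &&
    Nat.testBit u e1 && Nat.testBit u e2 && Nat.testBit WR e1 && Nat.testBit WR e2 &&
    ((avoid &&& (bitOf e1 ||| bitOf e2 ||| bitOf c1 ||| bitOf c2 ||| bitOf y ||| bitOf b)) == 0)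
  bif !static then 0 else
  let regA := sdiff WR (bitOf y ||| bitOf b ||| bitOf e2 ||| avoid)
  match bfsPathE u regA e1 c1 with
  | none => 0
  | some A =>
    let mA := maskOfList A
    let regY := sdiff WR (mA ||| bitOf b ||| avoid)
    match bfsPathE u regY y e2 with
    | none => 0
    | some Y =>
      let sp1 := mA ||| maskOfList Y
      bif !(pathOKE (WR ||| bitOf e1 ||| bitOf c1) A 0 && endsOK A e1 c1 && pathOKE (sdiff (WR ||| bitOf e2) mA) Y 0 && endsOK Y y e2) then 0 else
      let good1 := reachE u (sdiff W sp1) (bitOf b)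
      let oA2 := bif c2 == c1 then some A else bfsPathE u regA e1 c2
      match oA2 with
      | none => 0
      | some A2 =>
        let mA2 := maskOfList A2
        let regB := sdiff WR (mA2 ||| bitOf y ||| avoid)
        match bfsPathE u regB b e2 with
        | none => 0
        | some B =>
          let sp2 := mA2 ||| maskOfList B
          bif !(pathOKE (WR ||| bitOf e1 ||| bitOf c2) A2 0 && endsOK A2 e1 c2 && pathOKE (sdiff (WR ||| bitOf e2) mA2) B 0 && endsOK B b e2) then 0 else
          let good2 := reachE u (sdiff W sp2) (bitOf y)
          good1 &&& good2

/-! ## §5 Certificates and the chunk checker -/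

/-- Read `cnt` plans for the pair `(e₁, e₂)` and accumulate their cover masks. [folklore] -/
def CtxE.rdPlans (C : CtxE) (e1 e2 : ℕ) : ℕ → ℕ → ℕ → ℕ × ℕ
  | 0, n, acc => (acc, n)
  | cnt + 1, n, acc =>
    let p1 := rd n; let p2 := rd p1.2; let p3 := rd p2.2; let p4 := rd p3.2; let p5 := rd p4.2
    let av := rdMask p5.1 p5.2 0
    let cov := C.coverOf e1 e2 p1.1 p2.1 p3.1 p4.1 av.1
    C.rdPlans e1 e2 cnt av.2 (bif cov == 0 then acc else acc ||| cov)

/-- Check all partners `e₂` of `e₁` against the certificate numeral `n`. [folklore] -/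
def CtxE.checkRow (C : CtxE) (e1 : ℕ) : List ℕ → ℕ → Bool
  | [], _ => true
  | e2 :: rest, n =>
    bif e2 == e1 then C.checkRow e1 rest n else
    let need := C.needMask e1 e2
    bif need == 0 then C.checkRow e1 rest n else
    let p := rd n
    let r := C.rdPlans e1 e2 p.1 p.2 0
    bif sdiff need r.1 == 0 then C.checkRow e1 rest r.2 else false

/-- **The chunk checker**: the rows of the listed terminals `es₁` against one certificate numeral each. [folklore] -/
def CtxE.checkEs (C : CtxE) : List ℕ → List ℕ → Bool
  | [], _ => true
  | e1 :: rest, certs =>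
    match certs with
    | [] => false
    | n :: certs' => bif C.checkRow e1 C.esList n then C.checkEs rest certs' else false

/-- The instance's mask is admissible: inside the cleared block as the case prescribes (`W ⊆ allowed`) and containing every universe vertex of
`hexBall z 1` in it (`forced ⊆ W`). [folklore] -/
def CtxE.wOK (C : CtxE) (allowed forced : ℕ) : Bool := (sdiff C.W allowed == 0) && (sdiff forced C.W == 0)

end Bcc111.SK

end Summit.CriticalPhenomena.PercolationContinuityZ3.Theorems.Transplant
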